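import Summits.NavierStokesRegularity.FluidComputer.GateBudgetLadderClock
import Summits.NavierStokesRegularity.FluidComputer.GateBudgetDudHorizonTwoSided
import HarnessLib

/-!
# GateBudget part 86 — the clock dud horizon: numerics, the misfire ladder, the explicit horizon
# (§250–§251)

Cell `pub-fluidc`, blueprint seat bp1 (gen 37, fifth item: THE CLOCK HORIZON, SPEC-INPUT-bp1
§BN(4)(c)); namespace `Summit.NavierStokesRegularity.FluidComputer.GateBudget`, headline member
`RotorKnob.rotorCircuit K K¹⁰ ε ρ` of the two-scale family from `delayInit` (5.6), `K ≥ 16`, on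
the lattice window `200ε/K²⁰ ≤ ρ² ≤ 2ε/K¹⁰`, `ε² ≤ 1/(6K²⁰)`, `ε = kK¹⁰ρ²`; modes `0 = a`
(carrier), `1 = b` (clock), `2 = c` (trigger), `3 = d` (transfer), `4 = ã` (output).
HONEST FRAMING: a low prior, high value-of-information experiment on Tao's machine paradigm;
NOT a claim that NS blows up.

WHAT. Part 83 is re-read over part 85's clock ladder. §250 `clock_slip_numerics`: with part
83's dominating reals `D = 7/K⁴`, `U = 7/2 + k²/3 + 10⁻³` (`1 ≤ k ≤ K²`) the per-rung pair
slip of part 85 — whose cold term is the SHARP law `6(D + ι + 3/K⁹)/K⁹` instead of `6/K⁹` — is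
`≤ (1.1 + k²/10)/K⁹` (part 83: `(7 + k²/10)/K⁹`); §250 `knob_misfire_ladder_clock` is part
83 §243 with the clock window `(N - 1)·λ ≤ 0.144`, `λ = 43/K⁹ + 242 log K/K¹⁰`, and the pair
window `(N - 1)(1.1 + k²/10)/K⁹ ≤ 0.0199`: from part 83 §241's anchor `r₁ > 2.8282`, for every
`1 ≤ n ≤ N` a normal-form ignition `rₙ > 1.8282 + n` with `P(rₙ) ≤ 10⁻⁴ + (n - 1)(1.1 +
k²/10)/K⁹ ≤ 1/50`, `(n - 1)/K⁹ ≤ ã(rₙ) ≤ 0.1415`, `|d(rₙ)| ≤ 7/K⁴`. §251: for `k ≤ 6` the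
clock window implies the pair window (`clock_window_pair_clock`, using only `λ ≥ 43/K⁹`:
`4.7·0.144/43 ≤ 0.0199`), and the clock window holds for every `N - 1 ≤ 1.694·10⁻³K⁹`
(`clock_window_explicit`: `λ ≤ 85/K⁹` from `log K/K ≤ log 16/16`); so §251
`knob_dud_horizon_clock` / `knob_ladder_no_output_clock`: for `1 ≤ k ≤ 6` and every `1 ≤ N ≤ 1
+ 1.694·10⁻³K⁹` the member mis-fires `N` times and `ã ≤ 0.1415` on `[0, 1.8282 + N]` — an
EXPLICIT, LOG-FREE dud horizon `×3.37` part 83's `5.03·10⁻⁴K⁹` (`1.16·10⁸` rungs at `K =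
16` against `3.46·10⁷`).
HOW. §250's numerics are part 83 §242's with the cold term re-summed (`ι ≤ 1/K⁴`, `3/K⁹ ≤
3/K⁴`: `6(D + ι + 3/K⁹) ≤ 66/K⁴`); the ladder is part 85 §249 `knob_ladder_clock` at part 83
§241's anchor with `A₀ = 0`; §251 is arithmetic plus `RotorKnob.rotorCircuit_output_monotone`.
READING (SPEC-INPUT-bp1 §BO). The binding window is still the CLOCK (`43/K⁹` per rung, parts
59/60's hard-wired carrier-slope width); with it gone the pair window `0.0199K⁹/(1.1 + k²/10)`
(`9.0·10⁻³K⁹` at `k = 1`) would bind, and past that only the quadratic P-ledger (successor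
items (a)–(c) of §BO). The explicit horizon is stated for `k ≤ 6` because `(1.1 +
k²/10)·0.144/43 ≤ 0.0199` fails from `k = 7` on; §250 covers `k ≤ K²` with both windows.
HONEST LIMITS. (i) `1.694·10⁻³K⁹` uses `log K/K ≤ log 16/16` — at large `K` the true window
`0.144/λ → 3.35·10⁻³K⁹` is not claimed; (ii) existence per rung, no uniqueness, no gap law
beyond `rₙ₊₁ ≥ rₙ + 1`; (iii) `k = 0` is excluded by part 64; (iv) nothing about Navier–Stokes.
[cite: Tao2016AveragedNS, §5.5 Theorem 5.3, (5.5), (5.6), (b-eq), (c-eq), (d-eq), (ta-eq),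
(energy-con), (est)]
-/

noncomputable section

namespace Summit.NavierStokesRegularity.FluidComputer.GateBudget

open Real Set Filter Topology
open Literature.Analysis.FluidPDE.Tao2016AveragedNS

variable {K ε ρ : ℝ} {X : ℝ → Fin 5 → ℝ} {C : ℝ → ℝ}

/-! ## §250 Numerics of the sharp slip; the clock misfire ladder -/

/-- §250 NUMERICS (`K ≥ 16`, `1 ≤ k ≤ K²`): with `D = 7/K⁴`, `U = 7/2 + k²/3 + 10⁻³`, `ι = (2k +
3)/(5K⁹)` the sharp per-rung slip is `(0.2829 + U/K⁹)U/K⁹ + (2D + ι)ι + 6(D + ι + 3/K⁹)/K⁹ ≤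
(1.1 + k²/10)/K⁹`. [folklore] -/
theorem clock_slip_numerics (hK : 16 ≤ K) {k : ℝ} (hk1 : 1 ≤ k) (hkK : k ≤ K ^ 2) :
    (2829 / 10000 + (7 / 2 + k ^ 2 / 3 + 1 / 1000) / K ^ 9)
          * ((7 / 2 + k ^ 2 / 3 + 1 / 1000) / K ^ 9)
        + (2 * (7 / K ^ 4) + (2 * k + 3) / (5 * K ^ 9)) * ((2 * k + 3) / (5 * K ^ 9))
        + 6 * (7 / K ^ 4 + (2 * k + 3) / (5 * K ^ 9) + 3 / K ^ 9) / K ^ 9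
      ≤ (11 / 10 + k ^ 2 / 10) / K ^ 9 := by
  have hK0 : (0 : ℝ) < K := by linarith
  have hK1 : (1 : ℝ) ≤ K := by linarith
  have hk0 : 0 ≤ k := by linarith
  have hK4p : (0 : ℝ) < K ^ 4 := by positivity
  have hK9p : (0 : ℝ) < K ^ 9 := by positivity
  have h4 : (65536 : ℝ) ≤ K ^ 4 := by
    have := headline_pow_floor hK 4; norm_num at this; exact this
  have h5 : (1048576 : ℝ) ≤ K ^ 5 := by
    have := headline_pow_floor hK 5; norm_num at this; exact this
  obtain ⟨U, hU⟩ : ∃ U : ℝ, U = 7 / 2 + k ^ 2 / 3 + 1 / 1000 := ⟨_, rfl⟩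
  obtain ⟨ι, hι⟩ : ∃ ι : ℝ, ι = (2 * k + 3) / (5 * K ^ 9) := ⟨_, rfl⟩
  simp only [← hU, ← hι]
  have hk2 : k ^ 2 ≤ K ^ 4 := by nlinarith only [hkK, hk0]
  have hU0 : 0 ≤ U := by rw [hU]; positivity
  have hu : U / K ^ 9 ≤ 1 / 10000 := by
    rw [div_le_div_iff₀ hK9p (by norm_num), hU]
    have p := mul_le_mul_of_nonneg_left h5 hK4p.le
    have e : K ^ 4 * K ^ 5 = K ^ 9 := by ring
    nlinarith only [hk2, p, e, h4]
  have hι0 : 0 ≤ ι := by rw [hι]; positivity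
  have hι1 : ι ≤ 1 / K ^ 4 := by
    rw [hι, div_le_div_iff₀ (by positivity) hK4p]
    have p1 := mul_le_mul_of_nonneg_right hkK hK4p.le
    have p2 : K ^ 6 ≤ K ^ 9 := pow_le_pow_right₀ hK1 (by norm_num)
    have p3 : K ^ 4 ≤ K ^ 9 := pow_le_pow_right₀ hK1 (by norm_num)
    have e : K ^ 2 * K ^ 4 = K ^ 6 := by ring
    linarith only [p1, p2, p3, e]
  have h39 : (3 : ℝ) / K ^ 9 ≤ 3 / K ^ 4 :=
    div_le_div_of_nonneg_left (by norm_num) hK4p (pow_le_pow_right₀ hK1 (by norm_num))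
  have hιle : 2 * (7 / K ^ 4) + ι ≤ 15 / K ^ 4 := by
    have e : (15 : ℝ) / K ^ 4 = 2 * (7 / K ^ 4) + 1 / K ^ 4 := by ring
    linarith only [hι1, e]
  have h1 : (2829 / 10000 + U / K ^ 9) * (U / K ^ 9) ≤ 283 / 1000 * (U / K ^ 9) :=
    mul_le_mul_of_nonneg_right (by linarith only [hu]) (div_nonneg hU0 hK9p.le)
  have h2 := mul_le_mul_of_nonneg_right hιle hι0
  have h3 : 6 * (7 / K ^ 4 + ι + 3 / K ^ 9) / K ^ 9 ≤ 66 / K ^ 4 / K ^ 9 := by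
    refine div_le_div_of_nonneg_right ?_ hK9p.le
    have e : (66 : ℝ) / K ^ 4 = 6 * (7 / K ^ 4 + 1 / K ^ 4 + 3 / K ^ 4) := by ring
    linarith only [hι1, h39, e]
  have e : 283 / 1000 * (U / K ^ 9) + 15 / K ^ 4 * ι + 66 / K ^ 4 / K ^ 9
      = (283 / 1000 * U + 3 * (2 * k + 3) / K ^ 4 + 66 / K ^ 4) / K ^ 9 := by
    rw [hι]; field_simp; ring
  have h3' : 3 * (2 * k + 3) / K ^ 4 ≤ 3 * (2 * k + 3) / 65536 :=
    div_le_div_of_nonneg_left (by positivity) (by norm_num) h4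
  have h66 : (66 : ℝ) / K ^ 4 ≤ 66 / 65536 :=
    div_le_div_of_nonneg_left (by norm_num) (by norm_num) h4
  have hkk : k ≤ k ^ 2 := by nlinarith only [hk1]
  have key : 283 / 1000 * U + 3 * (2 * k + 3) / K ^ 4 + 66 / K ^ 4 ≤ 11 / 10 + k ^ 2 / 10 := by
    rw [hU]; linarith only [h3', h66, hkk, hk1]
  calc (2829 / 10000 + U / K ^ 9) * (U / K ^ 9) + (2 * (7 / K ^ 4) + ι) * ι
        + 6 * (7 / K ^ 4 + ι + 3 / K ^ 9) / K ^ 9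
      ≤ 283 / 1000 * (U / K ^ 9) + 15 / K ^ 4 * ι + 66 / K ^ 4 / K ^ 9 := by
        linarith only [h1, h2, h3]
    _ = (283 / 1000 * U + 3 * (2 * k + 3) / K ^ 4 + 66 / K ^ 4) / K ^ 9 := e
    _ ≤ (11 / 10 + k ^ 2 / 10) / K ^ 9 := div_le_div_of_nonneg_right key hK9p.le

/-- §250 **THE CLOCK MISFIRE LADDER.** Headline member from `delayInit` with a trigger primitive
`C`, `K ≥ 16`, lattice window, winding `1 ≤ k ≤ K²`, `λ = 43/K⁹ + 242 log K/K¹⁰`. For every `N`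
inside the clock window `(N - 1)·λ ≤ 0.144` and the pair window `(N - 1)·(1.1 + k²/10)/K⁹ ≤
0.0199`, and every `1 ≤ n ≤ N`: an ignition `rₙ > 1.8282 + n` in normal form, `b(rₙ) = θₙε`,
`5/4 ≤ θₙ ≤ 29/20`, `c(rₙ) = ρ²/K⁹`, with `P(rₙ) ≤ 10⁻⁴ + (n - 1)(1.1 + k²/10)/K⁹`, `P(rₙ) ≤
1/50`, `(n - 1)/K⁹ ≤ ã(rₙ) ≤ 0.1415`, `|d(rₙ)| ≤ 7/K⁴`.
[derived: part 83 §241/§242, §250, part 85 §249] -/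
theorem knob_misfire_ladder_clock
    (hX : ∀ t, HasDerivAt X (RotorKnob.rotorCircuit K (K ^ 10) ε ρ (X t)) t)
    (h0 : X 0 = delayInit) (hC : ∀ t, HasDerivAt C (X t 2) t) (hK : 16 ≤ K)
    (hε : 0 < ε) (hεK : ε ^ 2 ≤ 1 / (6 * K ^ 20)) (hρ : 0 < ρ)
    (hlo : 200 * ε / K ^ 20 ≤ ρ ^ 2) (hhi : K ^ 10 * ρ ^ 2 ≤ 2 * ε) (k : ℕ)
    (hk : ε = k * K ^ 10 * ρ ^ 2) (hkK : (k : ℝ) ≤ K ^ 2) (N : ℕ)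
    (hNθ : ((N : ℝ) - 1) * (43 / K ^ 9 + 242 * log K / K ^ 10) ≤ 144 / 1000)
    (hNP : ((N : ℝ) - 1) * ((11 / 10 + k ^ 2 / 10) / K ^ 9) ≤ 199 / 10000) :
    ∀ n : ℕ, 1 ≤ n → n ≤ N → ∃ r θ : ℝ, 18282 / 10000 + n < r ∧ X r 1 = θ * ε ∧
      5 / 4 ≤ θ ∧ θ ≤ 29 / 20 ∧ X r 2 = ρ ^ 2 / K ^ 9 ∧
      X r 3 ^ 2 + X r 4 ^ 2 ≤ 1 / 10000 + ((n : ℝ) - 1) * ((11 / 10 + k ^ 2 / 10) / K ^ 9) ∧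
      X r 3 ^ 2 + X r 4 ^ 2 ≤ 1 / 50 ∧
      ((n : ℝ) - 1) / K ^ 9 ≤ X r 4 ∧ X r 4 ≤ 1415 / 10000 ∧ |X r 3| ≤ 7 / K ^ 4 := by
  obtain ⟨r₁, θ₁, hr1, hb1, hθlo, hθhi, hc1, he0, hP1, hd1, hk1⟩ :=
    knob_ladder_anchor_member hX h0 hC hK hε hεK hρ hlo hhi k hk
  obtain ⟨hD, hU, -, hD0sq, hres⟩ := two_sided_numerics hK hk1 hkK
  have hS := clock_slip_numerics hK hk1 hkK
  have hθ₀lo : 5 / 4 + ((N : ℝ) - 1) * (43 / K ^ 9 + 242 * log K / K ^ 10) ≤ θ₁ := by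
    linarith only [hNθ, hθlo]
  have hNP' : (k * π / (49 / 100 * K ^ 10 - 1) + 2 / K ^ 10 + 245 / K ^ 8) ^ 2
      + (3 * (k * π / ((25 / 16 - 1 / 10 ^ 6) * K ^ 10 - 1) + 1 / K ^ 19
        + 310 * log K / K ^ 9) / 10 + 6 / K ^ 9)
      + ((N : ℝ) - 1) * ((11 / 10 + k ^ 2 / 10) / K ^ 9) ≤ 1 / 50 := by
    linarith only [hres, hNP]
  intro n hn hnN
  obtain ⟨r, θ, hr, hb, hθ1, hθ2, hc, hP, hP50, hA, ha, hd⟩ := knob_ladder_clock hX h0 hC hK hε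
    hεK hρ hlo hhi k hk (le_of_lt (by linarith only [hr1])) hb1 hc1 hP1 hθ₀lo
    (by linarith only [hθhi]) (by linarith only [hNθ]) le_rfl he0 hd1 hD hU hS hNP' n hn hnN
  refine ⟨r, θ, by linarith only [hr, hr1], hb, hθ1, hθ2, hc, by linarith only [hP, hD0sq],
    hP50, by simpa using hA, ha, hd⟩

/-! ## §251 Small winding: the explicit clock window is the horizon; no output while it lasts -/

/-- §251 CLOCK ⊂ PAIR for `k ≤ 6` (`K ≥ 16`, any real `y`): `y·λ ≤ 0.144` ⇒ `y·(1.1 + k²/10)/K⁹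
≤ 0.0199`, using only `λ ≥ 43/K⁹` (`4.7·0.144/43 ≤ 0.0199`). [folklore] -/
theorem clock_window_pair_clock (hK : 16 ≤ K) {k y : ℝ} (hk0 : 0 ≤ k) (hk : k ≤ 6)
    (hy : y * (43 / K ^ 9 + 242 * log K / K ^ 10) ≤ 144 / 1000) :
    y * ((11 / 10 + k ^ 2 / 10) / K ^ 9) ≤ 199 / 10000 := by
  have hK0 : (0 : ℝ) < K := by linarith
  have hK9 : (0 : ℝ) < K ^ 9 := by positivity
  rcases le_or_gt 0 y with hy0 | hy0
  · have hfine : 0 ≤ 242 * log K / K ^ 10 :=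
      div_nonneg (mul_nonneg (by norm_num) (Real.log_nonneg (by linarith))) (by positivity)
    have h43 : y * (43 / K ^ 9) ≤ 144 / 1000 :=
      (mul_le_mul_of_nonneg_left (by linarith only [hfine]) hy0).trans hy
    have e : y * ((11 / 10 + k ^ 2 / 10) / K ^ 9)
        = (11 / 10 + k ^ 2 / 10) / 43 * (y * (43 / K ^ 9)) := by
      field_simp
    have h1 := mul_le_mul_of_nonneg_left h43 (by positivity : (0 : ℝ) ≤ (11 / 10 + k ^ 2 / 10) / 43)
    have h2 : (11 / 10 + k ^ 2 / 10) / 43 * (144 / 1000) ≤ 199 / 10000 := by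
      rw [div_mul_eq_mul_div, div_le_iff₀ (by norm_num : (0 : ℝ) < 43)]
      nlinarith only [hk, hk0]
    rw [e]; exact h1.trans h2
  · have : y * ((11 / 10 + k ^ 2 / 10) / K ^ 9) ≤ 0 :=
      mul_nonpos_iff.2 (Or.inr ⟨hy0.le, by positivity⟩)
    linarith only [this]

/-- §251 THE EXPLICIT CLOCK WINDOW (`K ≥ 16`): `λ ≤ 85/K⁹` (`242 log K/K ≤ 242 log 16/16 ≤ 42`),
so `y ≤ 1.694·10⁻³K⁹` ⇒ `y·λ ≤ 0.144` (any real `y`). [folklore] -/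
theorem clock_window_explicit (hK : 16 ≤ K) {y : ℝ} (hy : y ≤ 1694 / 10 ^ 6 * K ^ 9) :
    y * (43 / K ^ 9 + 242 * log K / K ^ 10) ≤ 144 / 1000 := by
  have hK0 : (0 : ℝ) < K := by linarith
  have hK9 : (0 : ℝ) < K ^ 9 := by positivity
  have hK10 : (0 : ℝ) < K ^ 10 := by positivity
  have he16 : exp 1 ≤ 16 := by have := Real.exp_one_lt_d9; linarith
  have hmono := Real.log_div_self_antitoneOn (show (16 : ℝ) ∈ Set.Ici (exp 1) from he16)
    (show K ∈ Set.Ici (exp 1) from le_trans he16 hK) hK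
  simp only at hmono
  have hlog16 : log 16 ≤ 2773 / 1000 := by
    have e : log (16 : ℝ) = 4 * log 2 := by
      rw [show (16 : ℝ) = 2 ^ 4 by norm_num, Real.log_pow]; norm_num
    rw [e]; linarith only [Real.log_two_lt_d9]
  have hl : log K ≤ 2773 / 16000 * K := by
    rw [div_le_iff₀ hK0] at hmono
    have := mul_le_mul_of_nonneg_right (div_le_div_of_nonneg_right hlog16 (by norm_num :
      (0 : ℝ) ≤ 16)) hK0.le
    linarith only [hmono, this]
  have h1 : 242 * log K / K ^ 10 ≤ 42 / K ^ 9 := by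
    rw [div_le_div_iff₀ hK10 hK9]
    have := mul_le_mul_of_nonneg_right hl hK9.le
    have e : K * K ^ 9 = K ^ 10 := by ring
    nlinarith only [this, e, hK10]
  have hl85 : 43 / K ^ 9 + 242 * log K / K ^ 10 ≤ 85 / K ^ 9 := by
    have e : (85 : ℝ) / K ^ 9 = 43 / K ^ 9 + 42 / K ^ 9 := by ring
    linarith only [h1, e]
  obtain ⟨hl0, -, -⟩ := clock_numerics hK
  have h2 := mul_le_mul hy hl85 hl0 (by positivity)
  have e : 1694 / 10 ^ 6 * K ^ 9 * (85 / K ^ 9) = 143990 / 10 ^ 6 := by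
    field_simp; norm_num
  linarith only [h2, e]

/-- §251 **THE CLOCK DUD HORIZON, SMALL WINDING, EXPLICIT** (`1 ≤ k ≤ 6`, `K ≥ 16`): for every `N`
with `N - 1 ≤ 1.694·10⁻³K⁹` — log-free, `×3.37` part 83's `5.03·10⁻⁴K⁹` — §250's conclusion:
`N` clean mis-fires `rₙ > 1.8282 + n`, `P(rₙ) ≤ 10⁻⁴ + (n - 1)(1.1 + k²/10)/K⁹ ≤ 1/50`, `(n -
1)/K⁹ ≤ ã(rₙ) ≤ 0.1415`, `|d(rₙ)| ≤ 7/K⁴`. [derived: §250, §251] -/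
theorem knob_dud_horizon_clock
    (hX : ∀ t, HasDerivAt X (RotorKnob.rotorCircuit K (K ^ 10) ε ρ (X t)) t)
    (h0 : X 0 = delayInit) (hC : ∀ t, HasDerivAt C (X t 2) t) (hK : 16 ≤ K)
    (hε : 0 < ε) (hεK : ε ^ 2 ≤ 1 / (6 * K ^ 20)) (hρ : 0 < ρ)
    (hlo : 200 * ε / K ^ 20 ≤ ρ ^ 2) (hhi : K ^ 10 * ρ ^ 2 ≤ 2 * ε) (k : ℕ)
    (hk : ε = k * K ^ 10 * ρ ^ 2) (hk6 : k ≤ 6) (N : ℕ)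
    (hN : (N : ℝ) - 1 ≤ 1694 / 10 ^ 6 * K ^ 9) :
    ∀ n : ℕ, 1 ≤ n → n ≤ N → ∃ r θ : ℝ, 18282 / 10000 + n < r ∧ X r 1 = θ * ε ∧
      5 / 4 ≤ θ ∧ θ ≤ 29 / 20 ∧ X r 2 = ρ ^ 2 / K ^ 9 ∧
      X r 3 ^ 2 + X r 4 ^ 2 ≤ 1 / 10000 + ((n : ℝ) - 1) * ((11 / 10 + k ^ 2 / 10) / K ^ 9) ∧
      X r 3 ^ 2 + X r 4 ^ 2 ≤ 1 / 50 ∧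
      ((n : ℝ) - 1) / K ^ 9 ≤ X r 4 ∧ X r 4 ≤ 1415 / 10000 ∧ |X r 3| ≤ 7 / K ^ 4 := by
  have hK0 : (0 : ℝ) < K := by linarith
  have hk6' : (k : ℝ) ≤ 6 := by exact_mod_cast hk6
  have hkK : (k : ℝ) ≤ K ^ 2 := by nlinarith only [hk6', hK]
  have hNθ := clock_window_explicit hK hN
  exact knob_misfire_ladder_clock hX h0 hC hK hε hεK hρ hlo hhi k hk hkK N hNθ
    (clock_window_pair_clock hK (Nat.cast_nonneg k) hk6' hNθ)

/-- §251 **NO OUTPUT UP TO THE EXPLICIT HORIZON** (`1 ≤ k ≤ 6`, `K ≥ 16`, `1 ≤ N ≤ 1 +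
1.694·10⁻³K⁹`): `ã(t) ≤ 0.1415` for every `t ∈ [0, 1.8282 + N]` — the member has not fired (`ã`
is non-decreasing and `≤ 0.1415` at the `N`-th ignition `r_N > 1.8282 + N`); at `K = 16` that is
`1.16·10⁸` time units. [derived: §251, RotorKnob.rotorCircuit_output_monotone] -/
theorem knob_ladder_no_output_clock
    (hX : ∀ t, HasDerivAt X (RotorKnob.rotorCircuit K (K ^ 10) ε ρ (X t)) t)
    (h0 : X 0 = delayInit) (hC : ∀ t, HasDerivAt C (X t 2) t) (hK : 16 ≤ K)
    (hε : 0 < ε) (hεK : ε ^ 2 ≤ 1 / (6 * K ^ 20)) (hρ : 0 < ρ)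
    (hlo : 200 * ε / K ^ 20 ≤ ρ ^ 2) (hhi : K ^ 10 * ρ ^ 2 ≤ 2 * ε) (k : ℕ)
    (hk : ε = k * K ^ 10 * ρ ^ 2) (hk6 : k ≤ 6) (N : ℕ) (hN1 : 1 ≤ N)
    (hN : (N : ℝ) - 1 ≤ 1694 / 10 ^ 6 * K ^ 9) :
    ∀ t ∈ Icc (0 : ℝ) (18282 / 10000 + N), X t 4 ≤ 1415 / 10000 := by
  have hK0 : (0 : ℝ) < K := by linarith
  obtain ⟨r, θ, hr, -, -, -, -, -, -, -, ha, -⟩ :=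
    knob_dud_horizon_clock hX h0 hC hK hε hεK hρ hlo hhi k hk hk6 N hN N hN1 le_rfl
  intro t ht
  exact (RotorKnob.rotorCircuit_output_monotone hK0.le hX (by linarith only [ht.2, hr])).trans ha

end Summit.NavierStokesRegularity.FluidComputer.GateBudget

end
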